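import Summits.HodgeConjecture.CorCM.MultiFieldWeilPrimeDegreesOutsideClosures
import Mathlib.GroupTheory.GroupAction.Jordan
import Mathlib.GroupTheory.SpecificGroups.Alternating.Simple
import HarnessLib

/-!
# MULTI-FIELD WEIL ENGINE — CROSS-DEGREE MOVERS: between a slot of size `5` and a slot of size `3` the realised tuples are
# STABILISER-TRANSITIVE with NO hypothesis (`5 ∤ 3!`; Jordan's theorem and the simplicity of `𝔄₅`)

Cell `pub-hodgecm2` (COR-CM), seat b30 gen 38 (2026-08-25); count-neutral own lane MULTI-FIELD WEIL ENGINE (stem `MultiFieldWeil*`), sequel of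
`CorCM/MultiFieldWeilPrimeDegreesOutsideClosures.lean` (W1 §1 `stabTransitive_of_mover_prime`: on a slot of PRIME size, ONE mover trivial at `m₀` makes the tuples
trivial at `m₀` transitive).  Theorems only; no definition, no named fact, no `sorry`; pure group theory plus its reading on the realised tuples — no geometry and
no Markman binder in this file.  `HC_CM` is NOT touched.

THE QUESTION.  The multi-field Weil engine (V2 `hodgeConjectureFor_biproduct_comp_of_stabiliserTransitive_frames`) needs, for every ordered pair of slots `m₀ ≠ m`,
that the realised tuples `R ⊆ ∏_l Sym(n_l)` (the permutations of the conjugate pairs of the `K_l` induced by automorphisms of `ℂ` over `τ(k)`) which are TRIVIAL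
at `m₀` act TRANSITIVELY on the slot `m`.  For two slots of the SAME prime size this is a condition on the fields (W1 §3 sextic, Y1 decic: `Hom(K_m, K_{m₀}) = ∅`).
For a slot of size `5` (a DECIC CM field through `k`) and a slot of size `3` (a SEXTIC CM field through `k`) — in either order — it holds ALWAYS:

§1 **GROUP THEORY.**  `G` a group with homomorphisms `φ₀ : G → Sym(α)`, `φ : G → Sym(β)`; «no mover» means `ker φ₀ ≤ ker φ`.
* `card_dvd_index_ker_of_transitive`: `φ(G)` transitive on `β` ⟹ `|β| ∣ [G : ker φ]`.
* `not_ker_le_ker_of_not_dvd_factorial` (**small into large**): `ker φ₀ ≤ ker φ` forces `[G : ker φ] ∣ [G : ker φ₀] = |φ₀(G)| ∣ |α|!`; so a divisor `q` of `[G : ker φ]`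
  with `q ∤ |α|!` (e.g. `|β| = q = 5`, `|α| = 3`) gives a mover.
* `alternatingGroup_le_range_of_transitive_of_three_dvd` (**Jordan**): `φ₀(G) ≤ Sym(5)` transitive with `3 ∣ |φ₀(G)|` contains `𝔄₅` — Cauchy gives an element of
  order `3`, which on five letters is a `3`-cycle (`cycleType_prime_order`); a transitive group of prime degree is primitive (Mathlib `IsPreprimitive.of_prime_card`);
  a primitive group containing a `3`-cycle contains the alternating group (Mathlib `alternatingGroup_le_of_isPreprimitive_of_isThreeCycle_mem`, Jordan 1871).
* `index_ker_dvd_two_of_alternatingGroup_le_range` (**large onto small**): if `𝔄₅ ≤ φ₀(G)`, `ker φ₀ ≤ ker φ` and `5 ∤ |M|` for the finite target `M` of `φ`, then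
  `[G : ker φ] ∣ 2`: a lift `g` of the `5`-cycle `finRotate 5` has `g^{|M|} ∈ ker φ` over the NON-TRIVIAL `(finRotate 5)^{|M|}`, so the image `φ₀(ker φ)` —
  normalised by `φ₀(G) ⊇ 𝔄₅` — meets the SIMPLE group `𝔄₅` (Mathlib `alternatingGroup.isSimpleGroup_five`) in a non-trivial normal subgroup, i.e. contains `𝔄₅`, of
  index `∣ 2` in `Sym(5)`; and `[Sym(5) : φ₀(ker φ)] = [G : ker φ] · [Sym(5) : φ₀(G)]` (Mathlib `Subgroup.index_map`).
* `not_ker_le_ker_of_card_five_three`: hence `φ₀(G)` transitive on `5` letters and `φ(G)` transitive on `3` letters (`|Sym(3)| = 6`, `5 ∤ 6`; `3 ∣ [G : ker φ]`,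
  `3 ∤ 2`) ⟹ `ker φ₀ ≰ ker φ`.  (For `7` and `3` letters this FAILS: the Frobenius group `F₂₁ ≤ Sym(7)` maps onto `ℤ/3`.)

§2 **MODEL** (`R ⊆ ∏_l Sym(n_l)` closed under products and inverses, non-empty, transitive on the slots `m₀`, `m`): `stabTransitive_of_five_three` (`n_{m₀} = 5`,
`n_m = 3`) and `stabTransitive_of_three_five` (`n_{m₀} = 3`, `n_m = 5`): the tuples trivial at `m₀` are transitive on the slot `m` (a mover from §1 through the
evaluation homomorphisms, then W1 §1).

§3 **REALISED** (`stabTransitive_realisedTuples_of_five_three`, `…_of_three_five`; automorphism form `exists_aut_fix_comp_eq_of_three_five_sizes`): for a DECIC and a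
SEXTIC CM field through the imaginary quadratic `k` (frames `e`, `[K_l : ℚ] = 2 n_l`), for all `τ`-embeddings `s, s'` of the one field some automorphism of `ℂ` over
`τ(k)` fixes every `τ`-embedding of the other and carries `s` to `s'` — WITH NO HYPOTHESIS ON THE TWO FIELDS.  Consumer: Y3 `CorCM/MultiFieldWeilSexticsDecicsIntrinsic.lean`
(sextic and decic slots together, `Hom = ∅` asked within each degree only).

[cite: DixonMortimer1996, §1.6, Thm. 1.6A; §3.3, Thm. 3.3A] [cite: Wielandt1964, §13, Thm. 13.3] [cite: Lang2002, I §5 Thm. 5.5 and VI §1 Cor. 1.6]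
[cite: Shimura1998, §18.2 Lemma (i)]

## References
* [DixonMortimer1996] J. D. Dixon, B. Mortimer, *Permutation Groups*, GTM 163, §1.6 Thm. 1.6A (blocks), §3.3 Thm. 3.3A (Jordan: primitive + `3`-cycle ⟹ `⊇ 𝔄ₙ`).
* [Wielandt1964] H. Wielandt, *Finite permutation groups*, Academic Press 1964, §13, Thm. 13.3.
* [Lang2002] S. Lang, *Algebra*, GTM 211, I §5 Thm. 5.5 (`𝔄ₙ` simple, `n ≥ 5`), VI §1 Cor. 1.6.  [Shimura1998] G. Shimura, *Abelian varieties with complex multiplication and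
  modular functions*, §18.2 Lemma (i).
-/

noncomputable section

open CategoryTheory CategoryTheory.Limits NumberField IntermediateField

namespace Summit.HodgeConjecture.CorCM.MultiFieldWeil

open Finset
open Literature.NumberTheory.ComplexMultiplication
open Summit.HodgeConjecture.CorCM.Census.MultiFieldWeil

open scoped Classical

/-! ## §1 Group theory: kernels of two permutation representations -/

section Group

variable {G : Type} [Group G]

/-- **A transitive permutation image has order divisible by the degree**: `φ : G → Sym(β)` with `φ(G)` transitive on the finite non-empty `β` ⟹ `|β| ∣ [G : ker φ]`
(`ker φ ≤ Stab(x)` and `[G : Stab(x)] = |β|`). [cite: DixonMortimer1996, §1.6, Thm. 1.6A] -/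
theorem card_dvd_index_ker_of_transitive {β : Type} [Finite β] [Nonempty β] (φ : G →* Equiv.Perm β) (htr : ∀ x y : β, ∃ g : G, φ g x = y) :
    Nat.card β ∣ φ.ker.index := by
  letI : MulAction G β := MulAction.compHom β φ
  haveI : MulAction.IsPretransitive G β := ⟨fun x y => htr x y⟩
  obtain ⟨x⟩ := ‹Nonempty β›
  have hle : φ.ker ≤ MulAction.stabilizer G x := fun g hg => by
    rw [MonoidHom.mem_ker] at hg
    change φ g x = x
    rw [hg, Equiv.Perm.one_apply]
  rw [← MulAction.index_stabilizer_of_transitive G x]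
  exact Subgroup.index_dvd_of_le hle

/-- **SMALL INTO LARGE.**  `φ₀ : G → Sym(α)`, `φ : G → M`; if `ker φ₀ ≤ ker φ` then `[G : ker φ] ∣ [G : ker φ₀] = |φ₀(G)| ∣ |α|!`.  Hence a divisor `q` of `[G : ker φ]`
with `q ∤ |α|!` gives `ker φ₀ ≰ ker φ` (a mover: an element trivial under `φ₀`, non-trivial under `φ`). [cite: DixonMortimer1996, §1.6] -/
theorem not_ker_le_ker_of_not_dvd_factorial {α M : Type} [Fintype α] [Group M] (φ₀ : G →* Equiv.Perm α) (φ : G →* M) {q : ℕ}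
    (hq : q ∣ φ.ker.index) (hnot : ¬ q ∣ (Fintype.card α).factorial) : ¬ φ₀.ker ≤ φ.ker := fun hle => by
  have h1 : φ.ker.index ∣ φ₀.ker.index := Subgroup.index_dvd_of_le hle
  have h2 : φ₀.ker.index ∣ (Fintype.card α).factorial := by
    rw [Subgroup.index_ker, ← Fintype.card_perm, ← Nat.card_eq_fintype_card]
    exact Subgroup.card_subgroup_dvd_card _
  exact hnot (hq.trans (h1.trans h2))

/-- An element of order `3` of `Sym(5)` is a `3`-cycle (its cycle type is `(3, …, 3)` with sum `≤ 5`). [cite: DixonMortimer1996, §1.6] -/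
theorem isThreeCycle_of_orderOf_eq_three {σ : Equiv.Perm (Fin 5)} (h : orderOf σ = 3) : Equiv.Perm.IsThreeCycle σ := by
  obtain ⟨j, hj⟩ := Equiv.Perm.cycleType_prime_order (σ := σ) (by rw [h]; exact Nat.prime_three)
  rw [h] at hj
  have hsum := Equiv.Perm.sum_cycleType_le σ
  rw [hj, Multiset.sum_replicate, smul_eq_mul, Fintype.card_fin] at hsum
  obtain rfl : j = 0 := by omega
  change σ.cycleType = {3}
  rw [hj]
  rfl

/-- **JORDAN: a transitive subgroup of `Sym(5)` of order divisible by `3` contains `𝔄₅`** (image form: `φ₀(G)` transitive, `3 ∣ |φ₀(G)|`).  Cauchy: an element of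
order `3`, a `3`-cycle on five letters; prime degree ⟹ primitive; primitive + `3`-cycle ⟹ `⊇ 𝔄₅`. [cite: DixonMortimer1996, §3.3, Thm. 3.3A] [cite: Wielandt1964, §13, Thm. 13.3] -/
theorem alternatingGroup_le_range_of_transitive_of_three_dvd (φ₀ : G →* Equiv.Perm (Fin 5)) (htr₀ : ∀ x y : Fin 5, ∃ g : G, φ₀ g x = y)
    (h3 : 3 ∣ Nat.card φ₀.range) : alternatingGroup (Fin 5) ≤ φ₀.range := by
  haveI : MulAction.IsPretransitive (↥φ₀.range) (Fin 5) := ⟨fun x y => by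
    obtain ⟨g, hg⟩ := htr₀ x y
    exact ⟨⟨φ₀ g, ⟨g, rfl⟩⟩, hg⟩⟩
  have hprim : MulAction.IsPreprimitive (↥φ₀.range) (Fin 5) :=
    MulAction.IsPreprimitive.of_prime_card (by rw [Nat.card_eq_fintype_card, Fintype.card_fin]; exact Nat.prime_five)
  haveI : Fact (Nat.Prime 3) := ⟨Nat.prime_three⟩
  obtain ⟨x, hx⟩ := exists_prime_orderOf_dvd_card' 3 h3
  have h3c : Equiv.Perm.IsThreeCycle (x : Equiv.Perm (Fin 5)) := isThreeCycle_of_orderOf_eq_three (by rw [Subgroup.orderOf_coe, hx])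
  exact Equiv.Perm.alternatingGroup_le_of_isPreprimitive_of_isThreeCycle_mem hprim h3c x.2

/-- **LARGE ONTO SMALL.**  `𝔄₅ ≤ φ₀(G) ≤ Sym(5)`, `ker φ₀ ≤ ker φ` for `φ : G → M` with `M` finite and `5 ∤ |M|` ⟹ `[G : ker φ] ∣ 2`.  (A lift `g` of `finRotate 5 ∈ 𝔄₅`
has `g^{|M|} ∈ ker φ` over the non-trivial `(finRotate 5)^{|M|}`; so `φ₀(ker φ) ∩ 𝔄₅`, normal in the simple group `𝔄₅`, is all of `𝔄₅`; `[Sym(5) : φ₀(ker φ)] ∣ 2` and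
`[Sym(5) : φ₀(ker φ)] = [G : ker φ] · [Sym(5) : φ₀(G)]`.) [cite: Lang2002, I §5 Thm. 5.5] [cite: DixonMortimer1996, §3.3] -/
theorem index_ker_dvd_two_of_alternatingGroup_le_range {M : Type} [Group M] (φ₀ : G →* Equiv.Perm (Fin 5)) (φ : G →* M)
    (h5 : ¬ 5 ∣ Nat.card M) (hA : alternatingGroup (Fin 5) ≤ φ₀.range) (hker : φ₀.ker ≤ φ.ker) : φ.ker.index ∣ 2 := by
  -- the image `K₀ = φ₀(ker φ)` and its trace `N` on `𝔄₅`
  set K₀ : Subgroup (Equiv.Perm (Fin 5)) := φ.ker.map φ₀ with hK₀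
  set N : Subgroup ↥(alternatingGroup (Fin 5)) := K₀.subgroupOf (alternatingGroup (Fin 5)) with hNdef
  -- `N` is normal in `𝔄₅`: `K₀` is normalised by `φ₀(G) ⊇ 𝔄₅`
  haveI hN : N.Normal := ⟨fun a ha b => by
    rw [hNdef, Subgroup.mem_subgroupOf] at ha ⊢
    obtain ⟨x, hx, hxa⟩ := Subgroup.mem_map.1 ha
    obtain ⟨y, hy⟩ := hA b.2
    refine Subgroup.mem_map.2 ⟨y * x * y⁻¹, (MonoidHom.normal_ker φ).conj_mem x hx y, ?_⟩
    rw [map_mul, map_mul, map_inv, hxa, hy]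
    rfl⟩
  -- a lift of the `5`-cycle `finRotate 5`; its `|M|`-th power lies in `ker φ` over a non-trivial element of `𝔄₅`
  have hfr : finRotate 5 ∈ alternatingGroup (Fin 5) := Equiv.Perm.finRotate_bit1_mem_alternatingGroup (n := 2)
  obtain ⟨g, hg⟩ := hA hfr
  have hgM : g ^ Nat.card M ∈ φ.ker := by
    rw [MonoidHom.mem_ker, map_pow]
    exact pow_card_eq_one'
  have hord : orderOf (finRotate 5) = 5 := by
    rw [(isCycle_finRotate (n := 3)).orderOf, support_finRotate, Finset.card_univ, Fintype.card_fin]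
  have hne : (finRotate 5) ^ Nat.card M ≠ 1 := fun h1 => h5 (hord ▸ orderOf_dvd_of_pow_eq_one h1)
  have hmem : (⟨finRotate 5, hfr⟩ : ↥(alternatingGroup (Fin 5))) ^ Nat.card M ∈ N := by
    rw [hNdef, Subgroup.mem_subgroupOf, SubgroupClass.coe_pow]
    exact Subgroup.mem_map.2 ⟨g ^ Nat.card M, hgM, by rw [map_pow, hg]⟩
  -- `𝔄₅` is simple: `N = ⊤`
  have hNtop : N = ⊤ := hN.eq_bot_or_eq_top.resolve_left fun hbot => hne (by
    rw [hbot, Subgroup.mem_bot] at hmem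
    have h := congrArg Subtype.val hmem
    rwa [SubgroupClass.coe_pow] at h)
  have hAK : alternatingGroup (Fin 5) ≤ K₀ := fun a ha => by
    have h : (⟨a, ha⟩ : ↥(alternatingGroup (Fin 5))) ∈ N := by rw [hNtop]; exact Subgroup.mem_top _
    rw [hNdef, Subgroup.mem_subgroupOf] at h
    exact h
  -- indices
  have hidx : K₀.index ∣ 2 := by
    rw [← alternatingGroup.index_eq_two (α := Fin 5)]
    exact Subgroup.index_dvd_of_le hAK
  rw [hK₀, Subgroup.index_map, sup_eq_left.2 hker] at hidx
  exact (dvd_mul_right _ _).trans hidx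

/-- **`5` AND `3` LETTERS: NO FACTORING.**  `φ₀ : G → Sym(5)` and `φ : G → Sym(β)`, `|β| = 3`, both with transitive image ⟹ `ker φ₀ ≰ ker φ` (`3 ∣ [G : ker φ] ∣
[G : ker φ₀] = |φ₀(G)|` gives `𝔄₅ ≤ φ₀(G)` by Jordan; `5 ∤ 3! = |Sym(β)|` gives `[G : ker φ] ∣ 2`; `3 ∤ 2`). [cite: DixonMortimer1996, §3.3, Thm. 3.3A] [cite: Lang2002, I §5 Thm. 5.5] -/
theorem not_ker_le_ker_five_three {β : Type} [Fintype β] (hβ : Fintype.card β = 3) (φ₀ : G →* Equiv.Perm (Fin 5)) (φ : G →* Equiv.Perm β)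
    (htr₀ : ∀ x y : Fin 5, ∃ g : G, φ₀ g x = y) (htr : ∀ x y : β, ∃ g : G, φ g x = y) : ¬ φ₀.ker ≤ φ.ker := fun hker => by
  haveI : Nonempty β := Fintype.card_pos_iff.1 (by rw [hβ]; exact Nat.succ_pos 2)
  have h3 : 3 ∣ φ.ker.index := by
    have h := card_dvd_index_ker_of_transitive φ htr
    rwa [Nat.card_eq_fintype_card, hβ] at h
  have h3' : 3 ∣ Nat.card φ₀.range := by
    rw [← Subgroup.index_ker]
    exact h3.trans (Subgroup.index_dvd_of_le hker)
  have hA := alternatingGroup_le_range_of_transitive_of_three_dvd φ₀ htr₀ h3'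
  have h2 := index_ker_dvd_two_of_alternatingGroup_le_range φ₀ φ
    (by rw [Nat.card_perm, Nat.card_eq_fintype_card, hβ]; decide) hA hker
  have h32 : 3 ∣ 2 := h3.trans h2
  omega

/-- **`5` AND `3` LETTERS, ANY FIVE-ELEMENT TYPE** (transport of `not_ker_le_ker_five_three` along `α ≃ Fin 5`). [cite: DixonMortimer1996, §3.3, Thm. 3.3A] -/
theorem not_ker_le_ker_of_card_five_three {α β : Type} [Fintype α] [Fintype β] (hα : Fintype.card α = 5) (hβ : Fintype.card β = 3)
    (φ₀ : G →* Equiv.Perm α) (φ : G →* Equiv.Perm β) (htr₀ : ∀ x y : α, ∃ g : G, φ₀ g x = y) (htr : ∀ x y : β, ∃ g : G, φ g x = y) :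
    ¬ φ₀.ker ≤ φ.ker := fun hker => by
  let ε : α ≃ Fin 5 := Fintype.equivFinOfCardEq hα
  let φ₀' : G →* Equiv.Perm (Fin 5) := ε.permCongrHom.toMonoidHom.comp φ₀
  have happ : ∀ (g : G) (x : Fin 5), φ₀' g x = ε (φ₀ g (ε.symm x)) := fun g x => rfl
  refine not_ker_le_ker_five_three hβ φ₀' φ (fun x y => ?_) htr fun g hg => hker ?_
  · obtain ⟨g, hg⟩ := htr₀ (ε.symm x) (ε.symm y)
    exact ⟨g, by rw [happ, hg, Equiv.apply_symm_apply]⟩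
  · rw [MonoidHom.mem_ker] at hg ⊢
    have h : ε.permCongrHom (φ₀ g) = 1 := hg
    exact (MulEquiv.map_eq_one_iff _).1 h

/-- **`3` AND `5` LETTERS: NO FACTORING** (the easy direction).  `φ₀ : G → Sym(α)`, `|α| = 3`, and `φ : G → Sym(β)`, `|β| = 5`, with `φ(G)` transitive ⟹
`ker φ₀ ≰ ker φ` (`5 ∣ [G : ker φ]` but `5 ∤ 3!`). [cite: DixonMortimer1996, §1.6] -/
theorem not_ker_le_ker_of_card_three_five {α β : Type} [Fintype α] [Fintype β] (hα : Fintype.card α = 3) (hβ : Fintype.card β = 5)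
    (φ₀ : G →* Equiv.Perm α) (φ : G →* Equiv.Perm β) (htr : ∀ x y : β, ∃ g : G, φ g x = y) : ¬ φ₀.ker ≤ φ.ker := by
  haveI : Nonempty β := Fintype.card_pos_iff.1 (by rw [hβ]; exact Nat.succ_pos 4)
  refine not_ker_le_ker_of_not_dvd_factorial φ₀ φ (q := 5) ?_ (by rw [hα]; decide)
  have h := card_dvd_index_ker_of_transitive φ htr
  rwa [Nat.card_eq_fintype_card, hβ] at h

end Group

/-! ## §2 Model: slots of sizes `5` and `3` — a mover, hence stabiliser-transitivity (W1 §1) -/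

section Model

variable {r : ℕ} {n : Fin r → ℕ} {R : Finset (PermsG n)}

/-- **A MOVER BETWEEN SLOTS OF SIZES `5` AND `3` (either order).**  `R ⊆ ∏_l Sym(n_l)` closed under products and inverses, non-empty, transitive on the slots
`m₀` and `m` with `{n_{m₀}, n_m} = {3, 5}`: some tuple of `R` trivial at `m₀` moves a position of the slot `m` (§1 through the evaluation homomorphisms of the
group `R`). [cite: DixonMortimer1996, §3.3, Thm. 3.3A] [cite: Lang2002, I §5 Thm. 5.5] -/
theorem exists_mover_of_sizes_three_five (hmul : ∀ π ∈ R, ∀ π' ∈ R, π * π' ∈ R) (hinv : ∀ π ∈ R, π⁻¹ ∈ R) (hne : R.Nonempty) {m₀ m : Fin r}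
    (hsz : (n m₀ = 5 ∧ n m = 3) ∨ (n m₀ = 3 ∧ n m = 5)) (htr₀ : ∀ a a' : Fin (n m₀), ∃ π ∈ R, π m₀ a = a') (htr : ∀ a a' : Fin (n m), ∃ π ∈ R, π m a = a') :
    ∃ a : Fin (n m), ∃ ν ∈ R, ν m₀ = 1 ∧ ν m a ≠ a := by
  classical
  by_contra hno
  push Not at hno
  -- `R` as a group with its evaluation homomorphisms
  let Gs : Subgroup (PermsG n) :=
    { carrier := ↑R
      mul_mem' := fun {π π'} hπ hπ' => hmul π hπ π' hπ'
      one_mem' := one_mem_of_closed hmul hinv hne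
      inv_mem' := fun {π} hπ => hinv π hπ }
  let ev : ∀ l : Fin r, ↥Gs →* Equiv.Perm (Fin (n l)) := fun l => (Pi.evalMonoidHom (fun l : Fin r => Equiv.Perm (Fin (n l))) l).comp Gs.subtype
  have hev : ∀ (l : Fin r) (g : ↥Gs), ev l g = (g : PermsG n) l := fun l g => rfl
  have htr₀' : ∀ x y : Fin (n m₀), ∃ g : ↥Gs, ev m₀ g x = y := fun x y => by
    obtain ⟨π, hπ, h⟩ := htr₀ x y
    exact ⟨⟨π, hπ⟩, h⟩
  have htr' : ∀ x y : Fin (n m), ∃ g : ↥Gs, ev m g x = y := fun x y => by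
    obtain ⟨π, hπ, h⟩ := htr x y
    exact ⟨⟨π, hπ⟩, h⟩
  -- «no mover» says `ker (ev m₀) ≤ ker (ev m)`
  have hker : (ev m₀).ker ≤ (ev m).ker := fun g hg => by
    rw [MonoidHom.mem_ker, hev] at hg ⊢
    ext a
    exact congrArg Fin.val (hno a (g : PermsG n) g.2 hg)
  rcases hsz with ⟨h5, h3⟩ | ⟨h3, h5⟩
  · exact not_ker_le_ker_of_card_five_three (by rw [Fintype.card_fin, h5]) (by rw [Fintype.card_fin, h3]) (ev m₀) (ev m) htr₀' htr' hker
  · exact not_ker_le_ker_of_card_three_five (by rw [Fintype.card_fin, h3]) (by rw [Fintype.card_fin, h5]) (ev m₀) (ev m) htr' hker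

/-- **STABILISER-TRANSITIVITY BETWEEN SLOTS OF SIZES `5` AND `3`, NO HYPOTHESIS.**  `R ⊆ ∏_l Sym(n_l)` closed under products and inverses, non-empty, transitive on
the slots `m₀` and `m` with `{n_{m₀}, n_m} = {3, 5}`: the tuples of `R` trivial at `m₀` are TRANSITIVE on the slot `m` (a mover, `exists_mover_of_sizes_three_five`;
blocks of prime size, W1 `stabTransitive_of_mover_prime`). [cite: DixonMortimer1996, §1.6, Thm. 1.6A; §3.3, Thm. 3.3A] -/
theorem stabTransitive_of_sizes_three_five (hmul : ∀ π ∈ R, ∀ π' ∈ R, π * π' ∈ R) (hinv : ∀ π ∈ R, π⁻¹ ∈ R) (hne : R.Nonempty) {m₀ m : Fin r}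
    (hsz : (n m₀ = 5 ∧ n m = 3) ∨ (n m₀ = 3 ∧ n m = 5)) (htr₀ : ∀ a a' : Fin (n m₀), ∃ π ∈ R, π m₀ a = a') (htr : ∀ a a' : Fin (n m), ∃ π ∈ R, π m a = a')
    (a a' : Fin (n m)) : ∃ ν ∈ R, ν m₀ = 1 ∧ ν m a = a' :=
  stabTransitive_of_mover_prime hmul hinv hne (by rcases hsz with ⟨-, h⟩ | ⟨-, h⟩ <;> rw [h] <;> norm_num) htr
    (exists_mover_of_sizes_three_five hmul hinv hne hsz htr₀ htr) a a'

end Model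

/-! ## §3 Realised tuples: a decic and a sextic CM field through `k` — stabiliser-transitivity for free -/

section Realised

variable {I : Type} {r : ℕ} {Kf : I → Type} [∀ i, Field (Kf i)] [∀ i, NumberField (Kf i)] {i₀ : I} {is : Fin r → I} {n : Fin r → ℕ}
  {e : ∀ m : Fin r, (Kf (is m) →+* ℂ) ≃ Fin (n m) × Bool} {τ : Kf i₀ →+* ℂ} {im : ∀ m : Fin r, Kf i₀ →+* Kf (is m)}
  (he_sign : ∀ (m : Fin r) (s : Kf (is m) →+* ℂ), (e m s).2 = true ↔ s.comp (im m) = τ)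

include he_sign in
/-- **THE REALISED TUPLES TRIVIAL AT A SLOT OF SIZE `5` ARE TRANSITIVE ON A SLOT OF SIZE `3`, AND CONVERSELY — NO HYPOTHESIS.**  Frames `e l : Hom(K_l, ℂ) ≃ Fin (n l) × Bool`
reading the `τ`-fibres (`he_sign`), `{n_{m₀}, n_m} = {3, 5}`: for all positions `a, a'` of the slot `m` some realised tuple is trivial at `m₀` and carries `a` to `a'`
(the realised tuples are closed, non-empty and transitive on every slot: `transitive_realisedTuples`; §2). [cite: Shimura1998, §18.2 Lemma (i)]
[cite: DixonMortimer1996, §3.3, Thm. 3.3A] -/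
theorem stabTransitive_realisedTuples_of_sizes_three_five (m₀ m : Fin r) (hsz : (n m₀ = 5 ∧ n m = 3) ∨ (n m₀ = 3 ∧ n m = 5)) (a a' : Fin (n m)) :
    ∃ ν ∈ realisedTuples e τ, ν m₀ = 1 ∧ ν m a = a' :=
  stabTransitive_of_sizes_three_five (fun _ hπ _ hπ' => mul_mem_realisedTuples e τ hπ hπ') (fun _ hπ => inv_mem_realisedTuples hπ)
    (realisedTuples_nonempty (e := e) he_sign) hsz (fun b b' => transitive_realisedTuples (e := e) he_sign m₀ b b')
    (fun b b' => transitive_realisedTuples (e := e) he_sign m b b') a a'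

end Realised

/-! ## §3b The automorphism form (no frames) -/

section Aut

variable {I : Type} {r : ℕ} {Kf : I → Type} [∀ i, Field (Kf i)] [∀ i, NumberField (Kf i)] [∀ i, IsCMField (Kf i)]
  {i₀ : I} {is : Fin r → I} {n : Fin r → ℕ} {τ : Kf i₀ →+* ℂ}

/-- **A DECIC AND A SEXTIC CM FIELD THROUGH `k`: THE `hST` BINDER OF V2 FOR FREE.**  `k = Kf i₀` imaginary quadratic, `[K_l : ℚ] = 2 n_l` along `i_l : k → K_l` for all
slots, `{n_{m₀}, n_m} = {3, 5}`.  Then for all `τ`-embeddings `s, s'` of `K_m` some automorphism of `ℂ` over `τ(k)` fixes every `τ`-embedding of `K_{m₀}` and carries `s`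
to `s'` — whatever the two fields are. [cite: Shimura1998, §18.2 Lemma (i)] [cite: DixonMortimer1996, §3.3, Thm. 3.3A] [cite: Lang2002, I §5 Thm. 5.5] -/
theorem exists_aut_fix_comp_eq_of_sizes_three_five (h2 : Module.finrank ℚ (Kf i₀) = 2) (hdeg : ∀ l : Fin r, Module.finrank ℚ (Kf (is l)) = 2 * n l)
    (im : ∀ l : Fin r, Kf i₀ →+* Kf (is l)) (m₀ m : Fin r) (hsz : (n m₀ = 5 ∧ n m = 3) ∨ (n m₀ = 3 ∧ n m = 5))
    (s s' : Kf (is m) →+* ℂ) (hs : s.comp (im m) = τ) (hs' : s'.comp (im m) = τ) :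
    ∃ ρ : ℂ ≃+* ℂ, (ρ : ℂ →+* ℂ).comp τ = τ ∧ (∀ u : Kf (is m₀) →+* ℂ, u.comp (im m₀) = τ → (ρ : ℂ →+* ℂ).comp u = u) ∧ (ρ : ℂ →+* ℂ).comp s = s' := by
  have hττ : ComplexEmbedding.conjugate τ ≠ τ := QuarticCM.conjugate_ne τ
  have hk : ∀ σ : Kf i₀ →+* ℂ, σ = τ ∨ σ = ComplexEmbedding.conjugate τ := fun σ => QuarticCM.eq_or_eq_conjugate_of_quadratic h2 τ σ
  have hfr : ∀ l : Fin r, ∃ e : (Kf (is l) →+* ℂ) ≃ Fin (n l) × Bool, (∀ t, (e t).2 = true ↔ t.comp (im l) = τ) ∧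
      ∀ t, e (ComplexEmbedding.conjugate t) = ((e t).1, !(e t).2) := fun l => exists_signFrame (hdeg l) h2 (im l) hττ hk
  choose e he_sign _ using hfr
  have hsymm : ∀ (l : Fin r) (t : Kf (is l) →+* ℂ), t.comp (im l) = τ → (e l).symm ((e l t).1, true) = t := fun l t ht => by
    rw [show ((e l t).1, true) = e l t from Prod.ext rfl ((he_sign l t).2 ht).symm, Equiv.symm_apply_apply]
  obtain ⟨ν, hν, hν₀, hνa⟩ := stabTransitive_realisedTuples_of_sizes_three_five (e := e) he_sign m₀ m hsz (e m s).1 (e m s').1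
  obtain ⟨ρ, hρτ, hρ⟩ := (mem_realisedTuples e τ ν).1 hν
  refine ⟨ρ, hρτ, fun u hu => ?_, ?_⟩
  · have h := hρ m₀ (e m₀ u).1
    rwa [hν₀, hsymm m₀ u hu, Equiv.Perm.one_apply, hsymm m₀ u hu] at h
  · have h := hρ m (e m s).1
    rwa [hνa, hsymm m s hs, hsymm m s' hs'] at h

end Aut

end Summit.HodgeConjecture.CorCM.MultiFieldWeil

end
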